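import Summits.QuantumFields.YangMills.Theorems.BalabanUVNodesN15TwoSpacingGluingRecordKnitEntryOne
import Summits.QuantumFields.YangMills.Theorems.BalabanUVNodesN15TwoSpacingGluingNeumannKnitEntryOneDefect
import HarnessLib

/-!
# THE GLUING STEP AT TWO LATTICE SPACINGS, LXVII: THE TWO-GRID η-DEFECT OF THE «∇G» ENTRY OF THE RECORD COVER's PARAMETRIX — `𝔇(∇′_μG̃′, ∇_μG̃) ≤ D·(L^K)^{−1∕16}·e^{−δ|y−y′|_T}`,
# VOLUME FREE (dag-n15-c g14, FILE 110 = 85R; N15 = NE2, s1 «background-layer OPERATOR ingredient»)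

Cell `pub-ymgap`, seat `pub-ymgap-dag-n15-c` (R134 (a); HUMAN RULING D-0062), generation 14.  `bears_on: R4∕N15 · K3⁸ SpineGivenEndpointR13SepCoPHV (stmt-QuantumFields-27366)`.
Filed `--supports stmt-QuantumFields-27366 --as helper` — COUNT-NEUTRAL.  Theorems only (0 `def`, 0 `sorry`).  Imports BY NAME FILE 109 `…RecordKnitEntryOne` (through it the g12 record row `liftCubeG_grad_row_fine`; FILE
73's cover; programme P: P-IIb `hasMaj_chiCube_liftCubeG` ∕ `hasMaj_chiCube_grad_liftCubeG`, P-IId `hasMaj_chiCube_liftCubeG_fine`, P-IIc `hasMaj_idef_chiCube_liftCubeG` ∕ `hasMaj_idef_chiCube_grad_liftCubeG`)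
and FILE 85 `…NeumannKnitEntryOneDefect` (`entryOneDefectConst_le`; through it FILE 83 `hasMaj_idef_comp_parametrix_cut`, FILE 84 `coverH_shift_cut` ∕ `abs_coverH_shift_fine_sub_le`, FILE 64∕65
fits, FILE 67 letters, FILE 72, FILE 74 `coverFit_params`, `rpow_sixteenth_facts`); nothing in the tree is modified.

WHAT.  ★★★ **`hasMaj_idef_grad_parametrix_knitR`** — the record twin of FILE 85 `hasMaj_idef_grad_parametrix_knit`: for odd `L ≥ 3`, `a > 0` there are `δ, D > 0` such that for all `s`,
`m_T ≥ s + 1`, `K ≥ 1` (`4 ≤ L^K`), `r`, `μ`, on `MP (paramsOf d L m_T K hL)` with FILE 73's cover (lifted cubes `knitGR`, partition `knitHR`) at the two spacings `L^{−K}` ⊃ `L^{−(K+r)}`: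
  `𝔇(∇′_μG̃′, ∇_μG̃) ≤ D·(L^K)^{−1∕16}·e^{−δ|y−y′|_T}`
— row 11 of FILE 50's `GluedLetters` ON THE TORUS OF RECORD, `δ, D` free of `s`, of the volume `m_T`, of `K`, of `r`: FILE 83's two-grid engine with the TRUE overlap `(L+1)^{d+1}`, programme P's
cut rows (both spacings), lifted `χ_□∘∇∘G^{↑}` rows (both spacings), cut-cube defect and lifted `χ_□∘∇∘G^{↑}` defect, FILE 67's letters and FILE 64∕65∕84's two-grid fits of `h_k`, `h_k∘e_μ`, `∇h_k`.

HONEST FRAMING ∕ LIMITS.  Block-majorant bookkeeping over LANDED rows; `U ≡ 1` MODEL of [B6] §2's machine on the torus of record (cube letters from each cube's own doubled torus via programme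
P: not circular in the volume); constants crude and ours; nothing of [B5]∕[B6] (2.38)–(2.40)∕[B9] Thm 3.1, 3.14 asserted ([B9] Thm 3.14 = difference TEMPLATE).  NE2⁺ NOT PRINTED, NOT proved;
N15 NOT discharged; counts of record UNMOVED (typed 28∕28 · discharged 5∕27); one finite 𝕋⁴ at fixed ε per index — NOT infinite volume, NOT OS on ℝ⁴, NOT a mass gap, NOT Clay; R4 closes
`BalabanLadder.UV` only.  Restate-immune (no Theses import).
-/

noncomputable section

namespace Summit.QuantumFields.YangMills.BalabanUVNodes.N15.Gluing

open Real
open Literature.MathematicalPhysics.QuantumFieldTheory.Balaban1983to89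
open Literature.MathematicalPhysics.QuantumFieldTheory.Balaban1983to89.B5Prop11Plancherel (Tor fine)
open Literature.MathematicalPhysics.QuantumFieldTheory.Balaban1983to89.B11SectG (BlockNorm HasMaj RowSum)
open Literature.MathematicalPhysics.QuantumFieldTheory.Balaban1983to89.T4EtaRateDefect (idef)
open Literature.MathematicalPhysics.QuantumFieldTheory.Balaban1983to89.T4EtaRateCoeffDefect (pull)
open Literature.MathematicalPhysics.QuantumFieldTheory.Balaban1983to89.B6Prop26Gluing (mulOp mulOp_apply ind ind_nonneg ind_le_one)
open Literature.MathematicalPhysics.QuantumFieldTheory.Balaban1983to89.B6UnitTorusCarrier (unitTorusGeo)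
open Literature.MathematicalPhysics.QuantumFieldTheory.Balaban1983to89.B5SiteBridgeP12 (MP)
open Literature.MathematicalPhysics.QuantumFieldTheory.King1986.Torus (blockOf tdistT tdistT_nonneg)
open Summit.QuantumFields.YangMills.BalabanUVNodes.N15.VectorPiece (bshiftEquiv kingPrV blkFine)
open Summit.QuantumFields.YangMills.BalabanUVNodes.N15.BackgroundLayer (fgrad fgrad_apply symbOp_sD_eq)
open Summit.QuantumFields.YangMills.BalabanUVNodes.N15.TwoGrid (paramsOf deltaOp gOp chiCube cubeBlocks symbOp sD liftCubeG MP_dvd_MP hasMaj_chiCube_liftCubeG hasMaj_chiCube_liftCubeG_fine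
  hasMaj_chiCube_grad_liftCubeG hasMaj_idef_chiCube_liftCubeG hasMaj_idef_chiCube_grad_liftCubeG)

variable {d : ℕ}

section TwoGrid

variable {L : ℕ} [NeZero L]

/-- ★★★ **THE TWO-GRID η-DEFECT OF THE «∇G» ENTRY OF THE RECORD COVER's PARAMETRIX, VOLUME FREE** — the record twin of FILE 85: for odd `L ≥ 3`, `a > 0` there are `δ, D > 0` such that for
all `s`, `m_T ≥ s + 1`, `K ≥ 1` (`4 ≤ L^K`), `r`, `μ`, on `MP (paramsOf d L m_T K hL)` with FILE 73's cover at the spacings `L^{−K}` ⊃ `L^{−(K+r)}` (King's pairing),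
`𝔇(∇′_μG̃′, ∇_μG̃) ≤ D·(L^K)^{−1∕16}·e^{−δ|y−y′|_T}` — FILE 83 `hasMaj_idef_comp_parametrix_cut` with programme P's cut rows ∕ lifted `χ_□∘∇∘G^{↑}` rows at both spacings, P-IIc's cut-cube and
lifted-gradient defects, `|h| ≤ 1`, `|∇h| ≤ π∕L^s`, the two-grid fits of `h_k`, `h_k∘e_μ`, `∇h_k`, the TRUE overlap `(L+1)^{d+1}`; every `1∕L^s` bounded by `1`, every `(L^K)^{−·}` by `(L^K)^{−1∕16}`
(FILE 85 `entryOneDefectConst_le`). [cite: Balaban1984PropagatorsII, (2.91)–(2.93) p.239, (2.133)–(2.136) p.247 (shapes + mechanism); Balaban1985BackgroundPropagators, Thm 3.14 pp.426–427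
(difference template); King1986, Prop. 3.9 (3.73) p.665 (rate factor)] -/
theorem hasMaj_idef_grad_parametrix_knitR (hL : Odd L ∧ 1 < L) {a : ℝ} (ha : 0 < a) :
    ∃ δ D : ℝ, 0 < δ ∧ 0 < D ∧ ∀ (s mT K r : ℕ) (hs : s + 1 ≤ mT) (_hK : 1 ≤ K) (_hn4 : 4 ≤ L ^ K) (μ : Fin (d + 1)),
      HasMaj (BlockNorm.ofBlocks (unitTorusGeo L K (MP (paramsOf d L mT K hL)))
          (fun b : Tor (fine (L ^ K) (MP (paramsOf d L mT K hL))) × Fin (d + 1) => blockOf (L ^ K) (MP (paramsOf d L mT K hL)) b.1))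
        (BlockNorm.ofBlocks (unitTorusGeo L K (MP (paramsOf d L mT K hL)))
          (fun i : Tor (fine (L ^ r * L ^ K) (MP (paramsOf d L mT K hL))) × Fin (d + 1) => blockOf (L ^ r * L ^ K) (MP (paramsOf d L mT K hL)) i.1))
        (idef (pull (kingPrV L K r (MP (paramsOf d L mT K hL)))) (pull (kingPrV L K r (MP (paramsOf d L mT K hL))))
          (fgrad ((L ^ r * L ^ K : ℕ) : ℝ) (bshiftEquiv (MP (paramsOf d L mT K hL)) (L ^ r * L ^ K) μ) ∘ₗ
            parametrix (knitHR d L s mT K (L ^ r * L ^ K) hL) (knitGR d L s mT K (L ^ r * L ^ K) hL hs a))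
          (fgrad ((L ^ K : ℕ) : ℝ) (bshiftEquiv (MP (paramsOf d L mT K hL)) (L ^ K) μ) ∘ₗ
            parametrix (knitHR d L s mT K (L ^ K) hL) (knitGR d L s mT K (L ^ K) hL hs a)))
        (fun y y' => D * ((L ^ K : ℕ) : ℝ) ^ (-(1 / 16 : ℝ)) * Real.exp (-(δ * tdistT (MP (paramsOf d L mT K hL)) y y'))) := by
  have hL3 : 3 ≤ L := by obtain ⟨⟨j, hj⟩, h1⟩ := hL; omega
  have hLpos : 0 < L := by omega
  have hL1 : 1 ≤ L := hLpos
  have hLodd : Odd L := hL.1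
  have hL2 : 2 ≤ L := hL.2
  -- the letters
  obtain ⟨δ₀, C, hδ₀, hC, HG⟩ := hasMaj_chiCube_liftCubeG (d := d) hL ha
  obtain ⟨δ₀', C', hδ₀', hC', HG'⟩ := hasMaj_chiCube_liftCubeG_fine (d := d) hL ha
  obtain ⟨δD, βD, hδD, hβD, HD⟩ := hasMaj_chiCube_grad_liftCubeG (d := d) hL ha
  obtain ⟨δD', βD', hδD', hβD', HD'⟩ := liftCubeG_grad_row_fine (d := d) hL ha
  obtain ⟨δc, mc, hδc, hmc, HC⟩ := hasMaj_idef_chiCube_liftCubeG (d := d) hLodd hL2 ha (γ := 1 / 8) (by norm_num) (by norm_num)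
  obtain ⟨δe, me, hδe, hme, HE⟩ := hasMaj_idef_chiCube_grad_liftCubeG (d := d) hLodd hL2 ha
  set δ : ℝ := min (min (min δ₀ δ₀') (min δD δD')) (min δc δe) with hδ_def
  have hδ : 0 < δ := lt_min (lt_min (lt_min hδ₀ hδ₀') (lt_min hδD hδD')) (lt_min hδc hδe)
  have hd0 : δ ≤ δ₀ := (min_le_left _ _).trans ((min_le_left _ _).trans (min_le_left _ _))
  have hd0' : δ ≤ δ₀' := (min_le_left _ _).trans ((min_le_left _ _).trans (min_le_right _ _))
  have hdD : δ ≤ δD := (min_le_left _ _).trans ((min_le_right _ _).trans (min_le_left _ _))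
  have hdD' : δ ≤ δD' := (min_le_left _ _).trans ((min_le_right _ _).trans (min_le_right _ _))
  have hdc : δ ≤ δc := (min_le_right _ _).trans (min_le_left _ _)
  have hde : δ ≤ δe := (min_le_right _ _).trans (min_le_right _ _)
  set β : ℝ := C + C' with hβ_def
  have hβ : 0 ≤ β := by positivity
  have hCβ : C ≤ β := by rw [hβ_def]; linarith [hC'.le]
  have hCβ' : C' ≤ β := by rw [hβ_def]; linarith [hC.le]
  set β₁ : ℝ := βD + βD' with hβ₁_def
  have hβ₁ : 0 ≤ β₁ := by positivity
  have hDβ : βD ≤ β₁ := by rw [hβ₁_def]; linarith [hβD'.le]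
  have hDβ' : βD' ≤ β₁ := by rw [hβ₁_def]; linarith [hβD.le]
  set Nov : ℝ := (((L + 1) ^ (d + 1) : ℕ) : ℝ) with hNov_def
  set Ko : ℝ := π * (d + 1) with hKo_def
  set Kos : ℝ := π * (d + 1) + π + π with hKos_def
  set Kod : ℝ := 64 * π ^ 2 + π ^ 2 * (d + 1 : ℕ) with hKod_def
  set D : ℝ := Nov * ((β₁ * Ko + me + Kos * β₁) + (π * β * Ko + π * mc + Kod * β)) + 1 with hD_def
  refine ⟨δ, D, hδ, by positivity, fun s mT K r hs hK hn4 μ => ?_⟩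
  -- the index's data
  set M : Fin (d + 1) → ℕ := MP (paramsOf d L mT K hL) with hMdef
  have hs' : s ≤ mT := by omega
  have hM : ∀ ν, M ν = 2 * L ^ (mT - s) * L ^ s := MP_eq_two_mul L s mT K hL hs'
  have hw : 0 < L ^ s := pow_pos hLpos s
  have hq : 0 < L ^ (mT - s) := pow_pos hLpos _
  have hn : 1 ≤ L ^ K := Nat.one_le_pow _ _ hLpos
  have hn' : 1 ≤ L ^ r * L ^ K := Nat.one_le_iff_ne_zero.mpr (Nat.mul_ne_zero (pow_ne_zero r (NeZero.ne L)) (pow_ne_zero K (NeZero.ne L)))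
  have hfit := coverMargin_fit hL3 s
  have hSe : L ^ (s + 1) = L * L ^ s := by rw [pow_succ, mul_comm]
  have hfit1 : coverMargin L s + 2 * L ^ s + 1 ≤ L ^ (s + 1) := by rw [hSe]; omega
  have hS : L ^ (s + 1) ≤ 2 * L ^ (mT - s) * L ^ s := by
    calc L ^ (s + 1) ≤ L ^ mT := Nat.pow_le_pow_right hLpos hs
      _ = L ^ (mT - s) * L ^ s := by rw [← pow_add]; congr 1; omega
      _ ≤ 2 * L ^ (mT - s) * L ^ s := by rw [mul_assoc]; omega
  have hdiv : L ^ (s + 1) / L ^ s + 1 = L + 1 := by rw [hSe, Nat.mul_div_cancel _ hw]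
  have h3 : 3 ≤ L ^ K * L ^ s :=
    calc 3 ≤ L := hL3
      _ = L ^ 1 := (pow_one L).symm
      _ ≤ L ^ K := Nat.pow_le_pow_right hLpos hK
      _ = L ^ K * 1 := (mul_one _).symm
      _ ≤ L ^ K * L ^ s := Nat.mul_le_mul_left _ hw
  have hwR : (1 : ℝ) ≤ ((L ^ s : ℕ) : ℝ) := by exact_mod_cast hw
  have hnR : (1 : ℝ) ≤ ((L ^ K : ℕ) : ℝ) := by exact_mod_cast hn
  have hnn' : ((L ^ K : ℕ) : ℝ) ≤ ((L ^ r * L ^ K : ℕ) : ℝ) := by exact_mod_cast Nat.le_mul_of_pos_left (L ^ K) (pow_pos hLpos r)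
  set ε : ℝ := ((L ^ K : ℕ) : ℝ) ^ (-(1 / 16 : ℝ)) with hε_def
  obtain ⟨hnε, hnwε, hw1, hε0⟩ := rpow_sixteenth_facts hnR hwR
  have hexp16 : (-((1 : ℝ) / 8 / 2)) = -(1 / 16 : ℝ) := by norm_num
  have hblk : (fun i : Tor (fine (L ^ r * L ^ K) M) × Fin (d + 1) => blockOf (L ^ r * L ^ K) M i.1) =
      (fun b : Tor (fine (L ^ K) M) × Fin (d + 1) => blockOf (L ^ K) M b.1) ∘ kingPrV L K r M := (VectorPiece.blkFine_comp_kingPrV (M := M) L K r).symm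
  have hind : ∀ (k : Fin (d + 1) → ZMod (2 * L ^ (mT - s))) (y y' : Tor M),
      0 ≤ ind (g := unitTorusGeo L K M) ((cubeBlocks M (coverCorner M (L ^ s) (L ^ (mT - s)) (coverMargin L s) k) (L ^ (s + 1)) : Finset (Tor M)) : Set (Tor M)) y *
        ind (g := unitTorusGeo L K M) ((cubeBlocks M (coverCorner M (L ^ s) (L ^ (mT - s)) (coverMargin L s) k) (L ^ (s + 1)) : Finset (Tor M)) : Set (Tor M)) y' :=
    fun k y y' => mul_nonneg (ind_nonneg _ _) (ind_nonneg _ _)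
  -- cut rows at both spacings
  have hGc : ∀ k : Fin (d + 1) → ZMod (2 * L ^ (mT - s)),
      HasMaj (BlockNorm.ofBlocks (unitTorusGeo L K M) (fun b : Tor (fine (L ^ K) M) × Fin (d + 1) => blockOf (L ^ K) M b.1))
        (BlockNorm.ofBlocks (unitTorusGeo L K M) (fun b : Tor (fine (L ^ K) M) × Fin (d + 1) => blockOf (L ^ K) M b.1))
        (mulOp (chiCube M (L ^ K) (coverCorner M (L ^ s) (L ^ (mT - s)) (coverMargin L s) k) (L ^ (s + 1))) ∘ₗ knitGR d L s mT K (L ^ K) hL hs a k)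
        (fun y y' => ind ((cubeBlocks M (coverCorner M (L ^ s) (L ^ (mT - s)) (coverMargin L s) k) (L ^ (s + 1)) : Finset (Tor M)) : Set (Tor M)) y *
          ind ((cubeBlocks M (coverCorner M (L ^ s) (L ^ (mT - s)) (coverMargin L s) k) (L ^ (s + 1)) : Finset (Tor M)) : Set (Tor M)) y' * (β * Real.exp (-(δ * tdistT M y y')))) := fun k =>
    (hasMaj_rate_le (hind k) hC.le hd0 (HG (s + 1) mT K hs hK (coverCorner M (L ^ s) (L ^ (mT - s)) (coverMargin L s) k))).mono fun y y' =>
      mul_le_mul_of_nonneg_left (mul_le_mul_of_nonneg_right hCβ (Real.exp_nonneg _)) (hind k y y')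
  have hGc' : ∀ k : Fin (d + 1) → ZMod (2 * L ^ (mT - s)),
      HasMaj (BlockNorm.ofBlocks (unitTorusGeo L K M) ((fun b : Tor (fine (L ^ K) M) × Fin (d + 1) => blockOf (L ^ K) M b.1) ∘ kingPrV L K r M))
        (BlockNorm.ofBlocks (unitTorusGeo L K M) ((fun b : Tor (fine (L ^ K) M) × Fin (d + 1) => blockOf (L ^ K) M b.1) ∘ kingPrV L K r M))
        (mulOp (chiCube M (L ^ r * L ^ K) (coverCorner M (L ^ s) (L ^ (mT - s)) (coverMargin L s) k) (L ^ (s + 1))) ∘ₗ knitGR d L s mT K (L ^ r * L ^ K) hL hs a k)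
        (fun y y' => ind ((cubeBlocks M (coverCorner M (L ^ s) (L ^ (mT - s)) (coverMargin L s) k) (L ^ (s + 1)) : Finset (Tor M)) : Set (Tor M)) y *
          ind ((cubeBlocks M (coverCorner M (L ^ s) (L ^ (mT - s)) (coverMargin L s) k) (L ^ (s + 1)) : Finset (Tor M)) : Set (Tor M)) y' * (β * Real.exp (-(δ * tdistT M y y')))) := fun k => by
    rw [← hblk]
    exact (hasMaj_rate_le (hind k) hC'.le hd0' (HG' (s + 1) mT K r hs hK (coverCorner M (L ^ s) (L ^ (mT - s)) (coverMargin L s) k))).mono fun y y' =>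
      mul_le_mul_of_nonneg_left (mul_le_mul_of_nonneg_right hCβ' (Real.exp_nonneg _)) (hind k y y')
  have hDGc : ∀ k : Fin (d + 1) → ZMod (2 * L ^ (mT - s)),
      HasMaj (BlockNorm.ofBlocks (unitTorusGeo L K M) (fun b : Tor (fine (L ^ K) M) × Fin (d + 1) => blockOf (L ^ K) M b.1))
        (BlockNorm.ofBlocks (unitTorusGeo L K M) (fun b : Tor (fine (L ^ K) M) × Fin (d + 1) => blockOf (L ^ K) M b.1))
        (mulOp (chiCube M (L ^ K) (coverCorner M (L ^ s) (L ^ (mT - s)) (coverMargin L s) k) (L ^ (s + 1))) ∘ₗ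
          (fgrad ((L ^ K : ℕ) : ℝ) (bshiftEquiv M (L ^ K) μ) ∘ₗ knitGR d L s mT K (L ^ K) hL hs a k))
        (fun y y' => ind ((cubeBlocks M (coverCorner M (L ^ s) (L ^ (mT - s)) (coverMargin L s) k) (L ^ (s + 1)) : Finset (Tor M)) : Set (Tor M)) y *
          ind ((cubeBlocks M (coverCorner M (L ^ s) (L ^ (mT - s)) (coverMargin L s) k) (L ^ (s + 1)) : Finset (Tor M)) : Set (Tor M)) y' * (β₁ * Real.exp (-(δ * tdistT M y y')))) :=
    fun k => by
    have h := HD (s + 1) mT K hs hK (coverCorner M (L ^ s) (L ^ (mT - s)) (coverMargin L s) k) μ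
    rw [symbOp_sD_eq] at h
    exact (hasMaj_rate_le (hind k) hβD.le hdD h).mono fun y y' =>
      mul_le_mul_of_nonneg_left (mul_le_mul_of_nonneg_right hDβ (Real.exp_nonneg _)) (hind k y y')
  have hDGc' : ∀ k : Fin (d + 1) → ZMod (2 * L ^ (mT - s)),
      HasMaj (BlockNorm.ofBlocks (unitTorusGeo L K M) ((fun b : Tor (fine (L ^ K) M) × Fin (d + 1) => blockOf (L ^ K) M b.1) ∘ kingPrV L K r M))
        (BlockNorm.ofBlocks (unitTorusGeo L K M) ((fun b : Tor (fine (L ^ K) M) × Fin (d + 1) => blockOf (L ^ K) M b.1) ∘ kingPrV L K r M))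
        (mulOp (chiCube M (L ^ r * L ^ K) (coverCorner M (L ^ s) (L ^ (mT - s)) (coverMargin L s) k) (L ^ (s + 1))) ∘ₗ
          (fgrad ((L ^ r * L ^ K : ℕ) : ℝ) (bshiftEquiv M (L ^ r * L ^ K) μ) ∘ₗ knitGR d L s mT K (L ^ r * L ^ K) hL hs a k))
        (fun y y' => ind ((cubeBlocks M (coverCorner M (L ^ s) (L ^ (mT - s)) (coverMargin L s) k) (L ^ (s + 1)) : Finset (Tor M)) : Set (Tor M)) y *
          ind ((cubeBlocks M (coverCorner M (L ^ s) (L ^ (mT - s)) (coverMargin L s) k) (L ^ (s + 1)) : Finset (Tor M)) : Set (Tor M)) y' * (β₁ * Real.exp (-(δ * tdistT M y y')))) :=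
    fun k => by
    have h := HD' (s + 1) mT K r hs hK (coverCorner M (L ^ s) (L ^ (mT - s)) (coverMargin L s) k) μ
    rw [symbOp_sD_eq] at h
    rw [← hblk]
    exact (hasMaj_rate_le (hind k) hβD'.le hdD' h).mono fun y y' =>
      mul_le_mul_of_nonneg_left (mul_le_mul_of_nonneg_right hDβ' (Real.exp_nonneg _)) (hind k y y')
  -- cut defects
  have hIGc : ∀ k : Fin (d + 1) → ZMod (2 * L ^ (mT - s)),
      HasMaj (BlockNorm.ofBlocks (unitTorusGeo L K M) (fun b : Tor (fine (L ^ K) M) × Fin (d + 1) => blockOf (L ^ K) M b.1))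
        (BlockNorm.ofBlocks (unitTorusGeo L K M) ((fun b : Tor (fine (L ^ K) M) × Fin (d + 1) => blockOf (L ^ K) M b.1) ∘ kingPrV L K r M))
        (idef (pull (kingPrV L K r M)) (pull (kingPrV L K r M))
          (mulOp (chiCube M (L ^ r * L ^ K) (coverCorner M (L ^ s) (L ^ (mT - s)) (coverMargin L s) k) (L ^ (s + 1))) ∘ₗ knitGR d L s mT K (L ^ r * L ^ K) hL hs a k)
          (mulOp (chiCube M (L ^ K) (coverCorner M (L ^ s) (L ^ (mT - s)) (coverMargin L s) k) (L ^ (s + 1))) ∘ₗ knitGR d L s mT K (L ^ K) hL hs a k))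
        (fun y y' => ind ((cubeBlocks M (coverCorner M (L ^ s) (L ^ (mT - s)) (coverMargin L s) k) (L ^ (s + 1)) : Finset (Tor M)) : Set (Tor M)) y *
          ind ((cubeBlocks M (coverCorner M (L ^ s) (L ^ (mT - s)) (coverMargin L s) k) (L ^ (s + 1)) : Finset (Tor M)) : Set (Tor M)) y' * (mc * ε * Real.exp (-(δ * tdistT M y y')))) := fun k => by
    have h := HC (s + 1) mT K r hK hL hs (coverCorner M (L ^ s) (L ^ (mT - s)) (coverMargin L s) k)
    rw [hexp16] at h
    have h2 := hasMaj_rate_le (hind k) (by positivity : 0 ≤ mc * ε) hdc h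
    rw [hblk] at h2
    exact h2
  have hIDGc : ∀ k : Fin (d + 1) → ZMod (2 * L ^ (mT - s)),
      HasMaj (BlockNorm.ofBlocks (unitTorusGeo L K M) (fun b : Tor (fine (L ^ K) M) × Fin (d + 1) => blockOf (L ^ K) M b.1))
        (BlockNorm.ofBlocks (unitTorusGeo L K M) ((fun b : Tor (fine (L ^ K) M) × Fin (d + 1) => blockOf (L ^ K) M b.1) ∘ kingPrV L K r M))
        (idef (pull (kingPrV L K r M)) (pull (kingPrV L K r M))
          (mulOp (chiCube M (L ^ r * L ^ K) (coverCorner M (L ^ s) (L ^ (mT - s)) (coverMargin L s) k) (L ^ (s + 1))) ∘ₗ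
            (fgrad ((L ^ r * L ^ K : ℕ) : ℝ) (bshiftEquiv M (L ^ r * L ^ K) μ) ∘ₗ knitGR d L s mT K (L ^ r * L ^ K) hL hs a k))
          (mulOp (chiCube M (L ^ K) (coverCorner M (L ^ s) (L ^ (mT - s)) (coverMargin L s) k) (L ^ (s + 1))) ∘ₗ
            (fgrad ((L ^ K : ℕ) : ℝ) (bshiftEquiv M (L ^ K) μ) ∘ₗ knitGR d L s mT K (L ^ K) hL hs a k)))
        (fun y y' => ind ((cubeBlocks M (coverCorner M (L ^ s) (L ^ (mT - s)) (coverMargin L s) k) (L ^ (s + 1)) : Finset (Tor M)) : Set (Tor M)) y *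
          ind ((cubeBlocks M (coverCorner M (L ^ s) (L ^ (mT - s)) (coverMargin L s) k) (L ^ (s + 1)) : Finset (Tor M)) : Set (Tor M)) y' * (me * ε * Real.exp (-(δ * tdistT M y y')))) := fun k => by
    have h := HE (s + 1) mT K r hK hn4 hL hs (coverCorner M (L ^ s) (L ^ (mT - s)) (coverMargin L s) k) μ
    rw [symbOp_sD_eq, symbOp_sD_eq] at h
    have h2 := hasMaj_rate_le (hind k) (by positivity : 0 ≤ me * ε) hde h
    rw [hblk] at h2
    exact h2
  -- the partition: Leibniz at both spacings, cuts, sizes, fits, overlap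
  have hχ := fun ν k => chiCube_coverCorner_eq_one_side (M := M) (n := L ^ K) (m₀ := coverMargin L s) hM hw hfit1 hS ν k
  have hχ' := fun ν k => chiCube_coverCorner_eq_one_side (M := M) (n := L ^ r * L ^ K) (m₀ := coverMargin L s) hM hw hfit1 hS ν k
  have hleib : ∀ k : Fin (d + 1) → ZMod (2 * L ^ (mT - s)), fgrad ((L ^ K : ℕ) : ℝ) (bshiftEquiv M (L ^ K) μ) ∘ₗ mulOp (knitHR d L s mT K (L ^ K) hL k) =
      mulOp (knitHR d L s mT K (L ^ K) hL k ∘ ⇑(bshiftEquiv M (L ^ K) μ)) ∘ₗ fgrad ((L ^ K : ℕ) : ℝ) (bshiftEquiv M (L ^ K) μ) +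
        mulOp (fgrad ((L ^ K : ℕ) : ℝ) (bshiftEquiv M (L ^ K) μ) (knitHR d L s mT K (L ^ K) hL k)) := fun k => fgrad_comp_mulOp _ _ _
  have hleib' : ∀ k : Fin (d + 1) → ZMod (2 * L ^ (mT - s)), fgrad ((L ^ r * L ^ K : ℕ) : ℝ) (bshiftEquiv M (L ^ r * L ^ K) μ) ∘ₗ mulOp (knitHR d L s mT K (L ^ r * L ^ K) hL k) =
      mulOp (knitHR d L s mT K (L ^ r * L ^ K) hL k ∘ ⇑(bshiftEquiv M (L ^ r * L ^ K) μ)) ∘ₗ fgrad ((L ^ r * L ^ K : ℕ) : ℝ) (bshiftEquiv M (L ^ r * L ^ K) μ) +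
        mulOp (fgrad ((L ^ r * L ^ K : ℕ) : ℝ) (bshiftEquiv M (L ^ r * L ^ K) μ) (knitHR d L s mT K (L ^ r * L ^ K) hL k)) := fun k => fgrad_comp_mulOp _ _ _
  have hcuts := fun k : Fin (d + 1) → ZMod (2 * L ^ (mT - s)) => coverH_shift_cut (n := L ^ K) (m₀ := coverMargin L s) hM hw hfit1 hS μ k
  have hcutd := fun k : Fin (d + 1) → ZMod (2 * L ^ (mT - s)) => fgrad_hcube_cut (2 * L ^ (mT - s)) (coverXi M (L ^ K) (L ^ s)) (bshiftEquiv M (L ^ K)) μ ((L ^ K : ℕ) : ℝ) (hχ μ k)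
  have hcuts' := fun k : Fin (d + 1) → ZMod (2 * L ^ (mT - s)) => coverH_shift_cut (n := L ^ r * L ^ K) (m₀ := coverMargin L s) hM hw hfit1 hS μ k
  have hcutd' := fun k : Fin (d + 1) → ZMod (2 * L ^ (mT - s)) =>
    fgrad_hcube_cut (2 * L ^ (mT - s)) (coverXi M (L ^ r * L ^ K) (L ^ s)) (bshiftEquiv M (L ^ r * L ^ K)) μ ((L ^ r * L ^ K : ℕ) : ℝ) (hχ' μ k)
  have hh : ∀ (k : Fin (d + 1) → ZMod (2 * L ^ (mT - s))) x, |knitHR d L s mT K (L ^ K) hL k x| ≤ 1 := fun k x => abs_coverH_le_one k x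
  have hhs' : ∀ (k : Fin (d + 1) → ZMod (2 * L ^ (mT - s))) x', |(knitHR d L s mT K (L ^ r * L ^ K) hL k ∘ ⇑(bshiftEquiv M (L ^ r * L ^ K) μ)) x'| ≤ 1 :=
    fun k x' => abs_coverH_le_one k (bshiftEquiv M (L ^ r * L ^ K) μ x')
  have hdh' : ∀ (k : Fin (d + 1) → ZMod (2 * L ^ (mT - s))) x', |fgrad ((L ^ r * L ^ K : ℕ) : ℝ) (bshiftEquiv M (L ^ r * L ^ K) μ) (knitHR d L s mT K (L ^ r * L ^ K) hL k) x'| ≤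
      π / ((L ^ s : ℕ) : ℝ) := fun k x' => abs_fgrad_coverH_le hM hw k μ x'
  have hfitH : ∀ (k : Fin (d + 1) → ZMod (2 * L ^ (mT - s))) x', |knitHR d L s mT K (L ^ r * L ^ K) hL k x' - knitHR d L s mT K (L ^ K) hL k (kingPrV L K r M x')| ≤
      π * (d + 1) / (((L ^ K : ℕ) : ℝ) * ((L ^ s : ℕ) : ℝ)) := fun k x' => abs_coverH_fine_sub_le (L := L) (kk := K) (r := r) hM hw k x'
  have hfits : ∀ (k : Fin (d + 1) → ZMod (2 * L ^ (mT - s))) x', |(knitHR d L s mT K (L ^ r * L ^ K) hL k ∘ ⇑(bshiftEquiv M (L ^ r * L ^ K) μ)) x' -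
      (knitHR d L s mT K (L ^ K) hL k ∘ ⇑(bshiftEquiv M (L ^ K) μ)) (kingPrV L K r M x')| ≤
      π * (d + 1) / (((L ^ K : ℕ) : ℝ) * ((L ^ s : ℕ) : ℝ)) + π / ((L ^ s : ℕ) : ℝ) / ((L ^ r * L ^ K : ℕ) : ℝ) + π / ((L ^ s : ℕ) : ℝ) / ((L ^ K : ℕ) : ℝ) :=
    fun k x' => abs_coverH_shift_fine_sub_le (L := L) (kk := K) (r := r) hM hw k μ x'
  obtain ⟨hs0, hs13, hs1', hs1, hsL, hnκ, hnκ'⟩ := coverFit_params (L := L) (kk := K) (r := r) (w := L ^ s) hL1 hw h3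
  have hξ := fun ν ν' b => coverXi_shift (n := L ^ K) hM hw ν ν' b
  have hξ' := fun ν ν' b => coverXi_shift (n := L ^ r * L ^ K) hM hw ν ν' b
  have hoff := fun ν x' => coverXi_offset (M := M) (L := L) (kk := K) (r := r) (w := L ^ s) (q := L ^ (mT - s)) ν x'
  have hK2 : 2 ≤ 2 * L ^ (mT - s) := by omega
  have hLr : 1 ≤ L ^ r := Nat.one_le_pow _ _ hLpos
  have hfitd : ∀ (k : Fin (d + 1) → ZMod (2 * L ^ (mT - s))) x', |fgrad ((L ^ r * L ^ K : ℕ) : ℝ) (bshiftEquiv M (L ^ r * L ^ K) μ) (knitHR d L s mT K (L ^ r * L ^ K) hL k) x' -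
      fgrad ((L ^ K : ℕ) : ℝ) (bshiftEquiv M (L ^ K) μ) (knitHR d L s mT K (L ^ K) hL k) (kingPrV L K r M x')| ≤
      |((((L ^ s : ℕ) : ℝ)))⁻¹| * (((L ^ K : ℕ) : ℝ) * ((L ^ s : ℕ) : ℝ))⁻¹ * (64 * π ^ 2 + π ^ 2 * Fintype.card (Fin (d + 1))) := fun k x' =>
    abs_fgrad_hcube_two_grid_le (2 * L ^ (mT - s)) (coverXi M (L ^ K) (L ^ s)) (coverXi M (L ^ r * L ^ K) (L ^ s)) (kingPrV L K r M) (bshiftEquiv M (L ^ K))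
      (bshiftEquiv M (L ^ r * L ^ K)) hK2 hLr hs0 hs1' hsL hnκ hnκ' hξ hξ' hoff k μ x'
  have hN : ∀ y : Tor M, ∑ k : Fin (d + 1) → ZMod (2 * L ^ (mT - s)),
      ind (g := unitTorusGeo L K M) ((cubeBlocks M (coverCorner M (L ^ s) (L ^ (mT - s)) (coverMargin L s) k) (L ^ (s + 1)) : Finset _) : Set _) y ≤ Nov := fun y => by
    have h := sum_ind_cubeBlocks_le_overlap (S := L ^ (s + 1)) (m₀ := coverMargin L s) hM hw L K y
    rw [hdiv] at h
    exact h
  -- FILE 83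
  have key := hasMaj_idef_comp_parametrix_cut (g := unitTorusGeo L K M) (fun b : Tor (fine (L ^ K) M) × Fin (d + 1) => blockOf (L ^ K) M b.1) (kingPrV L K r M)
    (fun k => ((cubeBlocks M (coverCorner M (L ^ s) (L ^ (mT - s)) (coverMargin L s) k) (L ^ (s + 1)) : Finset (Tor M)) : Set (Tor M)))
    (D := fgrad ((L ^ K : ℕ) : ℝ) (bshiftEquiv M (L ^ K) μ)) (D' := fgrad ((L ^ r * L ^ K : ℕ) : ℝ) (bshiftEquiv M (L ^ r * L ^ K) μ))
    (G := knitGR d L s mT K (L ^ K) hL hs a) (G' := knitGR d L s mT K (L ^ r * L ^ K) hL hs a)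
    hβ hβ₁ zero_le_one (by positivity : (0 : ℝ) ≤ π / ((L ^ s : ℕ) : ℝ)) (by positivity) (by positivity) (by positivity) (by positivity : 0 ≤ mc * ε)
    (by positivity : 0 ≤ me * ε) hleib hleib' hcuts hcutd hcuts' hcutd' hh hhs' hdh' hfitH hfits hfitd hN hGc hGc' hDGc hDGc' hIGc hIDGc
  rw [← hblk] at key
  refine key.mono fun y y' => mul_le_mul_of_nonneg_right ?_ (Real.exp_nonneg _)
  -- the compression
  clear key hIDGc hIGc hDGc' hDGc hGc' hGc hleib hleib' hcuts hcutd hcuts' hcutd' hh hhs' hdh' hfitH hfits hfitd hN hξ hξ' hoff hχ hχ' HE HC HD HD' HG HG' hblk hind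
  rw [Fintype.card_fin]
  have hwpos : (0 : ℝ) < ((L ^ s : ℕ) : ℝ) := by linarith
  have hnpos : (0 : ℝ) < ((L ^ K : ℕ) : ℝ) := by linarith
  have hcdπ : π / ((L ^ s : ℕ) : ℝ) ≤ π := div_le_self Real.pi_pos.le hwR
  have ho : π * (d + 1) / (((L ^ K : ℕ) : ℝ) * ((L ^ s : ℕ) : ℝ)) ≤ Ko * ε := by
    rw [div_eq_mul_inv]; exact mul_le_mul_of_nonneg_left hnwε (by positivity)
  have hπw : π / ((L ^ s : ℕ) : ℝ) / ((L ^ K : ℕ) : ℝ) ≤ π * ε := by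
    rw [div_div, div_eq_mul_inv, mul_comm ((L ^ s : ℕ) : ℝ)]
    exact mul_le_mul_of_nonneg_left hnwε Real.pi_pos.le
  have hπw' : π / ((L ^ s : ℕ) : ℝ) / ((L ^ r * L ^ K : ℕ) : ℝ) ≤ π * ε := by
    refine le_trans ?_ hπw
    exact div_le_div_of_nonneg_left (by positivity) hnpos hnn'
  have hos : π * (d + 1) / (((L ^ K : ℕ) : ℝ) * ((L ^ s : ℕ) : ℝ)) + π / ((L ^ s : ℕ) : ℝ) / ((L ^ r * L ^ K : ℕ) : ℝ) + π / ((L ^ s : ℕ) : ℝ) / ((L ^ K : ℕ) : ℝ) ≤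
      Kos * ε := by
    calc _ ≤ Ko * ε + π * ε + π * ε := add_le_add (add_le_add ho hπw') hπw
      _ = Kos * ε := by rw [hKos_def, hKo_def]; ring
  have hod : |((((L ^ s : ℕ) : ℝ)))⁻¹| * (((L ^ K : ℕ) : ℝ) * ((L ^ s : ℕ) : ℝ))⁻¹ * (64 * π ^ 2 + π ^ 2 * (d + 1 : ℕ)) ≤ Kod * ε := by
    rw [abs_of_pos (inv_pos.mpr hwpos)]
    have t : (((L ^ s : ℕ) : ℝ))⁻¹ * (((L ^ K : ℕ) : ℝ) * ((L ^ s : ℕ) : ℝ))⁻¹ ≤ 1 * ε := mul_le_mul hw1 hnwε (by positivity) zero_le_one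
    rw [one_mul] at t
    calc (((L ^ s : ℕ) : ℝ))⁻¹ * (((L ^ K : ℕ) : ℝ) * ((L ^ s : ℕ) : ℝ))⁻¹ * (64 * π ^ 2 + π ^ 2 * (d + 1 : ℕ))
        ≤ ε * (64 * π ^ 2 + π ^ 2 * (d + 1 : ℕ)) := mul_le_mul_of_nonneg_right t (by positivity)
      _ = Kod * ε := by rw [hKod_def]; ring
  have hcomp := entryOneDefectConst_le (me := me) (by positivity : 0 ≤ Nov) hβ hβ₁ hcdπ (by positivity) hε0 hmc.le ho hos hod
  refine hcomp.trans ?_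
  rw [hD_def, add_mul _ (1 : ℝ) ε, one_mul]
  exact le_add_of_nonneg_right hε0


end TwoGrid

end Summit.QuantumFields.YangMills.BalabanUVNodes.N15.Gluing

end
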